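/-
Origin: expansion seat `planner-pub-hodgecm-pv02-g7-0`, handover NONE: imports HodgeCM.Automorphic.WeilThetaModelSchrodingerLinear (r27) + HodgeCM.PerL34.KernelOperator (tree) unchanged ; after WeilThetaModelSchrodingerLinear (RUN 27); independent of every other RUN-29 row (any order) (`HOME/pub-hodgecm-pv02-g7/lean/Pv02g7/WeilThetaModelLinear.lean`, md5 af979bb6, 425 lines);
landed by the gen-8 packager in gate run 29 as `HodgeCM/Automorphic/WeilThetaModelLinear.lean` (verbatim).
-/
/-
Origin: HOME/pub-hodgecm-pv02-g7/lean/Pv02g7/WeilThetaModelLinear.lean — session planner-pub-hodgecm-pv02-g7-0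
(unit pub-hodgecm-pv02-g7, DAG-NODE PROVER #02 gen 7; lineage pv02: N27 / `K`-finite Weil sub-models / kernels).
Intended final place (packager's call): `HodgeCM/Automorphic/WeilThetaModelLinear.lean`.
NEW ADDITIVE LEAF; imports the TREE modules `HodgeCM.Automorphic.WeilThetaModelSchrodingerLinear` (pv14-g4, r27; it
imports `WeilThetaModelSchrodinger` → `WeilThetaModel`) and `HodgeCM.PerL34.KernelOperator` (pv05, r19) only; no rewrite.
KIND: KERNEL over P-class STRUCTURE — nothing cited, nothing posited; no statement of PerL / QW8 / the 2001 programme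
is a hypothesis anywhere in this file.
-/
import Summits.HodgeConjecture.HodgeCM.Automorphic.WeilThetaModelSchrodingerLinear
import Summits.HodgeConjecture.HodgeCM.PerL34.KernelOperator

/-!
# The linear structure of a Weil theta model: `S(X_A)` a `ℂ`-vector space, `Φ ↦ SΦ` and `Φ ↦ Θ_Φ(S)` linear,
# `𝒮^κ` a subspace — and its consequences: `ω(h)`, `Φ ↦ θ_Φ` and `Φ ↦ 𝒯_{θ_Φ}` are `ℂ`-linear

prl1-g4's record `WeilThetaModel GU ΓU G Γ` (`HodgeCM/Automorphic/WeilThetaModel.lean`, r25) types Weil's datum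
[We64, Chap. III n° 37–41] with BARE carriers: `S(X_A)` is a topological space (`Literature.Theta.WeilThetaDatum.SX`,
`HodgeCM/Literature/WeilTheta1964.lean`) and `𝒮^κ = SK ⊆ S(X_A)` a bare subset — enough for the three structural laws
`omg_one / θ_cont / θ_omg` and for the whole kernel-model assembly, which never adds two `Φ`'s.  The S4 analytic side
does: pv12-g7's `ArchC.PrintedAnalyticSide` (and pv11-g9's torus-free / model variants) carry
`[AddCommGroup SK] [Module ℂ SK]`, `TΦc_add : 𝒯_{Φ+Ψ} = 𝒯_Φ + 𝒯_Ψ`, `TΦc_smul` and pure tensors `ins : 𝓕 →ₗ[ℂ] SK` as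
INPUTS typed over the index type `SK`; on the end state `SK = ↥(C.wm V c).SK` is a bare subtype of a set, so as things
stand they cannot even be instantiated there (pv11-g9, STATUS 2026-08-18T12:08:46Z).

This file supplies the missing layer ONE LEVEL DOWN, on Weil's datum, where it is print-shaped:

* §1 **`WeilThetaModel.LinearStr M`** (a class; P-class STRUCTURE fields — theorems in every constructed model,
  exactly like prl1-g4's `act_one` / `theta_act`; NOT cited facts):  `S(X_A)` is a `ℂ`-vector space ([We64] n° 11,
  n° 29: the Schwartz–Bruhat SPACE); every `Φ ↦ SΦ`, `S ∈ Mp(X)_A`, is additive and `ℂ`-homogeneous (n° 37, p. 188: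
  `Mp(X)_A ⊂ Ps(X)_A × 𝐁₀(X_A)` acts through its second component, a unitary — in particular linear — operator
  preserving `S(X_A)`); `Φ ↦ Θ_Φ(S) = Σ_{ξ ∈ X_k} (SΦ)(ξ)` (n° 41, p. 193)
  is additive and homogeneous; and `𝒮^κ` is a `ℂ`-subspace (PerL v5 l. 341, ll. 263–264: the `κ`-isotypic part
  of the `K_∞`-finite vectors — a linear subspace by definition).
* §2 CONSEQUENCES on `𝒮^κ` (KERNEL): `M.SKsub : Submodule ℂ M.W.SX`; instances `AddCommGroup ↥M.SK`, `Module ℂ ↥M.SK`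
  (`coe_add`, `coe_smul`, … by `rfl`); the inclusion `SKvalₗ : ↥M.SK →ₗ[ℂ] M.W.SX`; `ω(h)` is `ℂ`-linear
  (`omg_add`, `omg_smul`, `omg_zero`, `omgₗ h : ↥M.SK →ₗ[ℂ] ↥M.SK`).
* §3 THE KERNEL MAP IS LINEAR (KERNEL): `θ_{Φ+Ψ} = θ_Φ + θ_Ψ`, `θ_{aΦ} = a θ_Φ` in `C([G_U] × [U(W)], ℂ)`
  (`θ_add`, `θ_smul`, `θ_zero`, `θ_neg`, `θ_sub`, `θ_sum`, `θₗ : ↥M.SK →ₗ[ℂ] C((GU ⧸ ΓU) × (G ⧸ Γ), ℂ)`).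
* §4 THE KERNEL OPERATORS ARE LINEAR IN `Φ` (KERNEL, from pv05's `evalT_add_kernel / evalT_smul_kernel`): for any
  finite measure `ν` on a compact `[U(W)]`, `𝒯_{θ_{Φ+Ψ}} = 𝒯_{θ_Φ} + 𝒯_{θ_Ψ}` and `𝒯_{θ_{aΦ}} = a • 𝒯_{θ_Φ}` as bounded
  operators `L²(ν) →L[ℂ] C([G_U], ℂ)` (`KernelOperator.opTC_add_kernel / opTC_smul_kernel`, `opTC_θ_add / opTC_θ_smul`)
  — the literal shape of the S4 fields `TΦc_add / TΦc_smul` on a kernel-model core `𝒯_Φ := opTC (θ_Φ) ν`.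
* §5 NON-VACUITY (KERNEL): pv14-g4's archimedean Schrödinger–lattice model `SchwartzWeil.schrodingerModel E L m Γ hΓ`
  (and `schrodingerModelBot`) IS a linear Weil theta model — each field is one of pv14-g4's TREE theorems
  `SchwartzWeil.act_add / act_smul / theta_add / theta_smul` (`WeilThetaModelSchrodingerLinear`, r27), BY NAME.

Downstream (separate leaf of this seat, `HodgeCM/PerL34/ArchAWeilLinear.lean`): pv02-g6's `comapRight` and `kFinite`
inherit the linear structure (under linearity the `K`-finite vectors `finiteSK` form a SUBMODULE), so the genuine-torus
N27 witness `ArchAWeil.genuineSchrodingerModel` and its `K`-finite sub-models are linear Weil theta models.  The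
end-state discharge of the S4 fields `instSKacg / instSKmod / TΦc_add / TΦc_smul` over `[∀ V c, (C.wm V c).LinearStr]`
is two lines from §2 / §4 and is pv11-g9's node (their `ModelAnalyticSide`); it is deliberately NOT done here.

CONVENTION.  Everything about `𝒮^κ` is stated on the subtype `↥M.SK` of prl1-g4's record (the type over which
`omg`, `θ` and every downstream core are defined), NOT on `↥M.SKsub`; the two subtypes are definitionally equal and
the instances are transported by `inferInstanceAs`, so `(Φ + Ψ : ↥M.SK).1 = Φ.1 + Ψ.1` holds by `rfl` (`coe_add`).
-/

set_option autoImplicit false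

noncomputable section

open Topology

namespace HodgeCM

open Literature.Theta

namespace WeilThetaModel

variable {GU : Type} [Group GU] [TopologicalSpace GU] {ΓU : Subgroup GU}
variable {G : Type} [Group G] [TopologicalSpace G] {Γ : Subgroup G}

/-! ## 1. The linear structure -/

/-- **Linear structure of a Weil theta model** (P-class STRUCTURE, [We64] n° 11 / 29 / 37 / 41 + PerL v5 l. 341):
`S(X_A)` is a `ℂ`-vector space, each `Φ ↦ SΦ` (`S ∈ Mp(X)_A`) is `ℂ`-linear, `Φ ↦ Θ_Φ(S)` is `ℂ`-linear, and the
index space `𝒮^κ ⊆ S(X_A)` is a `ℂ`-subspace.  A class, so that the derived instances on `↥M.SK` are found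
automatically; constructed models register instances (§5, `ArchAWeilLinear`). -/
class LinearStr (M : WeilThetaModel GU ΓU G Γ) where
  /-- P [We64 n° 11, n° 29]: `S(X_A)` is an additive commutative group … -/
  [instACG : AddCommGroup M.W.SX]
  /-- … and a `ℂ`-vector space. -/
  [instMod : Module ℂ M.W.SX]
  /-- P [We64 n° 37, p. 188: `SΦ = 𝐬Φ`, `𝐬 ∈ 𝐁₀(X_A)` unitary]: each `Φ ↦ SΦ` is additive … -/
  act_add : ∀ (S : M.W.Mp) (Φ Ψ : M.W.SX), M.W.act S (Φ + Ψ) = M.W.act S Φ + M.W.act S Ψ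
  /-- … and `ℂ`-homogeneous. -/
  act_smul : ∀ (S : M.W.Mp) (a : ℂ) (Φ : M.W.SX), M.W.act S (a • Φ) = a • M.W.act S Φ
  /-- DEF [We64 n° 41 p. 193, `Θ(S) = Σ_{ξ ∈ X_k} (SΦ)(ξ)`]: `Φ ↦ Θ_Φ(S)` is additive … -/
  theta_add : ∀ (Φ Ψ : M.W.SX) (S : M.W.Mp), M.W.theta (Φ + Ψ) S = M.W.theta Φ S + M.W.theta Ψ S
  /-- … and `ℂ`-homogeneous. -/
  theta_smul : ∀ (a : ℂ) (Φ : M.W.SX) (S : M.W.Mp), M.W.theta (a • Φ) S = a * M.W.theta Φ S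
  /-- DEF (PerL v5 l. 341): `𝒮^κ` contains `0` … -/
  zero_mem : (0 : M.W.SX) ∈ M.SK
  /-- … is closed under addition … -/
  add_mem : ∀ {Φ Ψ : M.W.SX}, Φ ∈ M.SK → Ψ ∈ M.SK → Φ + Ψ ∈ M.SK
  /-- … and under scalar multiplication. -/
  smul_mem : ∀ (a : ℂ) {Φ : M.W.SX}, Φ ∈ M.SK → a • Φ ∈ M.SK

namespace LinearStr

/-- The additive group structure of `S(X_A)` carried by a linear Weil theta model (registered as an instance). -/
instance toAddCommGroupSX (M : WeilThetaModel GU ΓU G Γ) [h : M.LinearStr] : AddCommGroup M.W.SX := h.instACG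

/-- The `ℂ`-vector-space structure of `S(X_A)` carried by a linear Weil theta model (registered as an instance). -/
instance toModuleSX (M : WeilThetaModel GU ΓU G Γ) [h : M.LinearStr] : Module ℂ M.W.SX := h.instMod

variable {M : WeilThetaModel GU ΓU G Γ} [M.LinearStr]

/-- (Ported verbatim from the HodgeCMPerL package; no docstring in the source.) -/
theorem act_zero (S : M.W.Mp) : M.W.act S (0 : M.W.SX) = 0 := by
  simpa using (act_smul S (0 : ℂ) (0 : M.W.SX))

/-- (Ported verbatim from the HodgeCMPerL package; no docstring in the source.) -/
theorem act_neg (S : M.W.Mp) (Φ : M.W.SX) : M.W.act S (-Φ) = -M.W.act S Φ := by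
  simpa using (act_smul S (-1 : ℂ) Φ)

/-- (Ported verbatim from the HodgeCMPerL package; no docstring in the source.) -/
theorem theta_zero (S : M.W.Mp) : M.W.theta (0 : M.W.SX) S = 0 := by
  simpa using (theta_smul (0 : ℂ) (0 : M.W.SX) S)

/-- (Ported verbatim from the HodgeCMPerL package; no docstring in the source.) -/
theorem theta_neg (Φ : M.W.SX) (S : M.W.Mp) : M.W.theta (-Φ) S = -M.W.theta Φ S := by
  simpa using (theta_smul (-1 : ℂ) Φ S)

/-- (Ported verbatim from the HodgeCMPerL package; no docstring in the source.) -/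
theorem neg_mem {Φ : M.W.SX} (hΦ : Φ ∈ M.SK) : -Φ ∈ M.SK := by
  simpa using (smul_mem (-1 : ℂ) hΦ)

variable (M)

/-- `Φ ↦ SΦ` as a `ℂ`-linear map of `S(X_A)` (n° 37). -/
def actₗ (S : M.W.Mp) : M.W.SX →ₗ[ℂ] M.W.SX where
  toFun := M.W.act S
  map_add' := act_add S
  map_smul' := act_smul S

/-- (Ported verbatim from the HodgeCMPerL package; no docstring in the source.) -/
@[simp] theorem actₗ_apply (S : M.W.Mp) (Φ : M.W.SX) : actₗ M S Φ = M.W.act S Φ := rfl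

/-- `Φ ↦ Θ_Φ(S)` as a `ℂ`-linear functional on `S(X_A)` (n° 41). -/
def thetaₗ (S : M.W.Mp) : M.W.SX →ₗ[ℂ] ℂ where
  toFun Φ := M.W.theta Φ S
  map_add' Φ Ψ := theta_add Φ Ψ S
  map_smul' a Φ := theta_smul a Φ S

/-- (Ported verbatim from the HodgeCMPerL package; no docstring in the source.) -/
@[simp] theorem thetaₗ_apply (S : M.W.Mp) (Φ : M.W.SX) : thetaₗ M S Φ = M.W.theta Φ S := rfl

end LinearStr

/-! ## 2. `𝒮^κ` is a `ℂ`-vector space; `ω(h)` is linear -/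

section SK

variable (M : WeilThetaModel GU ΓU G Γ) [M.LinearStr]

/-- **`𝒮^κ` as a `ℂ`-submodule of `S(X_A)`.** -/
def SKsub : Submodule ℂ M.W.SX where
  carrier := M.SK
  zero_mem' := LinearStr.zero_mem
  add_mem' := LinearStr.add_mem
  smul_mem' := LinearStr.smul_mem

/-- (Ported verbatim from the HodgeCMPerL package; no docstring in the source.) -/
@[simp] theorem mem_SKsub (Φ : M.W.SX) : Φ ∈ M.SKsub ↔ Φ ∈ M.SK := Iff.rfl

/-- (Ported verbatim from the HodgeCMPerL package; no docstring in the source.) -/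
theorem coe_SKsub : (M.SKsub : Set M.W.SX) = M.SK := rfl

/-- **`𝒮^κ` (the subtype `↥M.SK` of prl1-g4's record) is an additive commutative group** — transported from `↥M.SKsub`
(the two subtypes are definitionally equal). -/
instance instAddCommGroupSK : AddCommGroup M.SK := inferInstanceAs (AddCommGroup M.SKsub)

/-- **… and a `ℂ`-vector space.** -/
instance instModuleSK : Module ℂ M.SK := inferInstanceAs (Module ℂ M.SKsub)

/-- (Ported verbatim from the HodgeCMPerL package; no docstring in the source.) -/
@[simp] theorem coe_add (Φ Ψ : M.SK) : ((Φ + Ψ : M.SK) : M.W.SX) = (Φ : M.W.SX) + Ψ := rfl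

/-- (Ported verbatim from the HodgeCMPerL package; no docstring in the source.) -/
@[simp] theorem coe_smul (a : ℂ) (Φ : M.SK) : ((a • Φ : M.SK) : M.W.SX) = a • (Φ : M.W.SX) := rfl

/-- (Ported verbatim from the HodgeCMPerL package; no docstring in the source.) -/
@[simp] theorem coe_zero : ((0 : M.SK) : M.W.SX) = 0 := rfl

/-- (Ported verbatim from the HodgeCMPerL package; no docstring in the source.) -/
@[simp] theorem coe_neg (Φ : M.SK) : ((-Φ : M.SK) : M.W.SX) = -(Φ : M.W.SX) := rfl

/-- (Ported verbatim from the HodgeCMPerL package; no docstring in the source.) -/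
@[simp] theorem coe_sub (Φ Ψ : M.SK) : ((Φ - Ψ : M.SK) : M.W.SX) = (Φ : M.W.SX) - Ψ := rfl

/-- (Ported verbatim from the HodgeCMPerL package; no docstring in the source.) -/
theorem coe_sum {ι : Type*} (s : Finset ι) (Φ : ι → M.SK) :
    ((∑ i ∈ s, Φ i : M.SK) : M.W.SX) = ∑ i ∈ s, (Φ i : M.W.SX) :=
  map_sum (M.SKsub.subtype) _ s

/-- (Ported verbatim from the HodgeCMPerL package; no docstring in the source.) -/
theorem mk_add_mk (Φ Ψ : M.W.SX) (hΦ : Φ ∈ M.SK) (hΨ : Ψ ∈ M.SK) :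
    (⟨Φ, hΦ⟩ + ⟨Ψ, hΨ⟩ : M.SK) = ⟨Φ + Ψ, LinearStr.add_mem hΦ hΨ⟩ := rfl

/-- (Ported verbatim from the HodgeCMPerL package; no docstring in the source.) -/
theorem smul_mk (a : ℂ) (Φ : M.W.SX) (hΦ : Φ ∈ M.SK) :
    (a • ⟨Φ, hΦ⟩ : M.SK) = ⟨a • Φ, LinearStr.smul_mem a hΦ⟩ := rfl

/-- The inclusion `𝒮^κ ⊆ S(X_A)` as a `ℂ`-linear map. -/
def SKvalₗ : M.SK →ₗ[ℂ] M.W.SX where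
  toFun := Subtype.val
  map_add' := M.coe_add
  map_smul' := M.coe_smul

/-- (Ported verbatim from the HodgeCMPerL package; no docstring in the source.) -/
@[simp] theorem SKvalₗ_apply (Φ : M.SK) : M.SKvalₗ Φ = (Φ : M.W.SX) := rfl

/-- (Ported verbatim from the HodgeCMPerL package; no docstring in the source.) -/
theorem SKvalₗ_injective : Function.Injective M.SKvalₗ := Subtype.val_injective

/-- **`ω(h)` is additive on `𝒮^κ`** (`ω(h)Φ = s(1, h)·Φ` and n° 37). -/
theorem omg_add (h : G) (Φ Ψ : M.SK) : M.omg h (Φ + Ψ) = M.omg h Φ + M.omg h Ψ :=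
  Subtype.ext (by simp only [coe_omg, coe_add, LinearStr.act_add])

/-- **`ω(h)` is `ℂ`-homogeneous on `𝒮^κ`.** -/
theorem omg_smul (h : G) (a : ℂ) (Φ : M.SK) : M.omg h (a • Φ) = a • M.omg h Φ :=
  Subtype.ext (by simp only [coe_omg, coe_smul, LinearStr.act_smul])

/-- (Ported verbatim from the HodgeCMPerL package; no docstring in the source.) -/
@[simp] theorem omg_zero (h : G) : M.omg h (0 : M.SK) = 0 :=
  Subtype.ext (by simp only [coe_omg, coe_zero, LinearStr.act_zero])

/-- (Ported verbatim from the HodgeCMPerL package; no docstring in the source.) -/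
theorem omg_neg (h : G) (Φ : M.SK) : M.omg h (-Φ) = -M.omg h Φ :=
  Subtype.ext (by simp only [coe_omg, coe_neg, LinearStr.act_neg])

/-- **`ω(h)` as a `ℂ`-linear endomorphism of `𝒮^κ`.** -/
def omgₗ (h : G) : M.SK →ₗ[ℂ] M.SK where
  toFun := M.omg h
  map_add' := M.omg_add h
  map_smul' := M.omg_smul h

/-- (Ported verbatim from the HodgeCMPerL package; no docstring in the source.) -/
@[simp] theorem omgₗ_apply (h : G) (Φ : M.SK) : M.omgₗ h Φ = M.omg h Φ := rfl

/-- (Ported verbatim from the HodgeCMPerL package; no docstring in the source.) -/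
theorem omg_sub (h : G) (Φ Ψ : M.SK) : M.omg h (Φ - Ψ) = M.omg h Φ - M.omg h Ψ :=
  map_sub (M.omgₗ h) Φ Ψ

/-- (Ported verbatim from the HodgeCMPerL package; no docstring in the source.) -/
theorem omg_sum (h : G) {ι : Type*} (s : Finset ι) (Φ : ι → M.SK) :
    M.omg h (∑ i ∈ s, Φ i) = ∑ i ∈ s, M.omg h (Φ i) :=
  map_sum (M.omgₗ h) Φ s

/-- (Ported verbatim from the HodgeCMPerL package; no docstring in the source.) -/
@[simp] theorem omgₗ_one : M.omgₗ (1 : G) = LinearMap.id :=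
  LinearMap.ext fun Φ => M.omg_one Φ

/-! ## 3. The kernel map `Φ ↦ θ_Φ` is `ℂ`-linear -/

/-- The kernel upstairs is additive in `Φ` (pointwise, on `G_U × G`). -/
theorem thetaFun_add (Φ Ψ : M.W.SX) (p : GU × G) :
    M.thetaFun (Φ + Ψ) p = M.thetaFun Φ p + M.thetaFun Ψ p :=
  LinearStr.theta_add Φ Ψ _

/-- … and homogeneous. -/
theorem thetaFun_smul (a : ℂ) (Φ : M.W.SX) (p : GU × G) :
    M.thetaFun (a • Φ) p = a * M.thetaFun Φ p :=
  LinearStr.theta_smul a Φ _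

variable [IsTopologicalGroup GU] [IsTopologicalGroup G]

/-- **`θ_{Φ+Ψ} = θ_Φ + θ_Ψ` in `C([G_U] × [U(W)], ℂ)`** (checked on representatives: `θ_mk` + n° 41). -/
theorem θ_add (Φ Ψ : M.SK) : M.θ (Φ + Ψ) = M.θ Φ + M.θ Ψ := by
  ext ⟨ξ, q⟩
  induction ξ using QuotientGroup.induction_on with
  | H x =>
    induction q using QuotientGroup.induction_on with
    | H y => simp only [ContinuousMap.add_apply, θ_mk, coe_add, LinearStr.theta_add]

/-- **`θ_{aΦ} = a • θ_Φ`.** -/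
theorem θ_smul (a : ℂ) (Φ : M.SK) : M.θ (a • Φ) = a • M.θ Φ := by
  ext ⟨ξ, q⟩
  induction ξ using QuotientGroup.induction_on with
  | H x =>
    induction q using QuotientGroup.induction_on with
    | H y => simp only [ContinuousMap.smul_apply, θ_mk, coe_smul, LinearStr.theta_smul, smul_eq_mul]

/-- **The kernel map `Φ ↦ θ_Φ` as a `ℂ`-linear map `𝒮^κ →ₗ[ℂ] C([G_U] × [U(W)], ℂ)`.** -/
def θₗ : M.SK →ₗ[ℂ] C((GU ⧸ ΓU) × (G ⧸ Γ), ℂ) where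
  toFun := M.θ
  map_add' := M.θ_add
  map_smul' := M.θ_smul

/-- (Ported verbatim from the HodgeCMPerL package; no docstring in the source.) -/
@[simp] theorem θₗ_apply (Φ : M.SK) : M.θₗ Φ = M.θ Φ := rfl

/-- (Ported verbatim from the HodgeCMPerL package; no docstring in the source.) -/
@[simp] theorem θ_zero : M.θ (0 : M.SK) = 0 := map_zero M.θₗ

/-- (Ported verbatim from the HodgeCMPerL package; no docstring in the source.) -/
theorem θ_neg (Φ : M.SK) : M.θ (-Φ) = -M.θ Φ := map_neg M.θₗ Φ

/-- (Ported verbatim from the HodgeCMPerL package; no docstring in the source.) -/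
theorem θ_sub (Φ Ψ : M.SK) : M.θ (Φ - Ψ) = M.θ Φ - M.θ Ψ := map_sub M.θₗ Φ Ψ

/-- (Ported verbatim from the HodgeCMPerL package; no docstring in the source.) -/
theorem θ_sum {ι : Type*} (s : Finset ι) (Φ : ι → M.SK) :
    M.θ (∑ i ∈ s, Φ i) = ∑ i ∈ s, M.θ (Φ i) :=
  map_sum M.θₗ Φ s

/-- `θₗ` intertwines `ω(h)` with the translation `q ↦ h⁻¹ • q` (structural law 3, now between linear maps):
`θₗ ∘ ωₗ(h) = (F ↦ F(·, h⁻¹ • ·)) ∘ θₗ`, pointwise. -/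
theorem θₗ_omgₗ (h : G) (Φ : M.SK) (ξ : GU ⧸ ΓU) (q : G ⧸ Γ) :
    M.θₗ (M.omgₗ h Φ) (ξ, q) = M.θₗ Φ (ξ, h⁻¹ • q) :=
  M.θ_omg h Φ ξ q

/-- `Φ ↦ θ_Φ` is a CONTINUOUS linear map as soon as `𝒮^κ` carries the subspace topology it has in prl1-g4's record
(structural law 2 `θ_cont` + linearity). -/
theorem θₗ_continuous : Continuous M.θₗ := M.θ_cont

end SK

/-! ## 4. The kernel operators `𝒯_{θ_Φ}` are linear in `Φ` -/

end WeilThetaModel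

namespace PerL34
namespace KernelOperator

open MeasureTheory

variable {X Y : Type*} [TopologicalSpace X] [TopologicalSpace Y]
variable [CompactSpace Y] [MeasurableSpace Y] [BorelSpace Y] [CompactSpace X]

/-- **`𝒯_{k₁ + k₂} = 𝒯_{k₁} + 𝒯_{k₂}`** as bounded operators `L²(ν) →L[ℂ] C(X, ℂ)` (pv05's `evalT_add_kernel`,
operator form). -/
theorem opTC_add_kernel (k₁ k₂ : C(X × Y, ℂ)) (ν : Measure Y) [IsFiniteMeasure ν] :
    opTC (k₁ + k₂) ν = opTC k₁ ν + opTC k₂ ν := by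
  ext v x
  simp [evalT_add_kernel]

/-- **`𝒯_{c • k} = c • 𝒯_k`** as bounded operators (pv05's `evalT_smul_kernel`, operator form). -/
theorem opTC_smul_kernel (c : ℂ) (k : C(X × Y, ℂ)) (ν : Measure Y) [IsFiniteMeasure ν] :
    opTC (c • k) ν = c • opTC k ν := by
  ext v x
  simp [evalT_smul_kernel]

/-- `k ↦ 𝒯_k` as a `ℂ`-linear map into the bounded operators `L²(ν) →L[ℂ] C(X, ℂ)`. -/
def opTCₗ (ν : Measure Y) [IsFiniteMeasure ν] : C(X × Y, ℂ) →ₗ[ℂ] (Lp ℂ 2 ν →L[ℂ] C(X, ℂ)) where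
  toFun k := opTC k ν
  map_add' k₁ k₂ := opTC_add_kernel k₁ k₂ ν
  map_smul' c k := opTC_smul_kernel c k ν

/-- (Ported verbatim from the HodgeCMPerL package; no docstring in the source.) -/
@[simp] theorem opTCₗ_apply (ν : Measure Y) [IsFiniteMeasure ν] (k : C(X × Y, ℂ)) : opTCₗ ν k = opTC k ν := rfl

/-- (Ported verbatim from the HodgeCMPerL package; no docstring in the source.) -/
@[simp] theorem opTC_zero_kernel (ν : Measure Y) [IsFiniteMeasure ν] : opTC (0 : C(X × Y, ℂ)) ν = 0 :=
  map_zero (opTCₗ (X := X) ν)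

/-- (Ported verbatim from the HodgeCMPerL package; no docstring in the source.) -/
theorem opTC_sub_kernel (k₁ k₂ : C(X × Y, ℂ)) (ν : Measure Y) [IsFiniteMeasure ν] :
    opTC (k₁ - k₂) ν = opTC k₁ ν - opTC k₂ ν :=
  map_sub (opTCₗ ν) k₁ k₂

/-- (Ported verbatim from the HodgeCMPerL package; no docstring in the source.) -/
theorem opTC_sum_kernel {ι : Type*} (s : Finset ι) (k : ι → C(X × Y, ℂ)) (ν : Measure Y) [IsFiniteMeasure ν] :
    opTC (∑ i ∈ s, k i) ν = ∑ i ∈ s, opTC (k i) ν :=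
  map_sum (opTCₗ ν) k s

end KernelOperator
end PerL34

namespace WeilThetaModel

open MeasureTheory PerL34.KernelOperator

variable {GU : Type} [Group GU] [TopologicalSpace GU] [IsTopologicalGroup GU] {ΓU : Subgroup GU}
variable {G : Type} [Group G] [TopologicalSpace G] [IsTopologicalGroup G] {Γ : Subgroup G}
variable (M : WeilThetaModel GU ΓU G Γ) [M.LinearStr]
variable [CompactSpace (GU ⧸ ΓU)] [CompactSpace (G ⧸ Γ)] [MeasurableSpace (G ⧸ Γ)] [BorelSpace (G ⧸ Γ)]
  (ν : Measure (G ⧸ Γ)) [IsFiniteMeasure ν]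

/-- **`𝒯_{θ_{Φ+Ψ}} = 𝒯_{θ_Φ} + 𝒯_{θ_Ψ}`** as bounded operators `L²([U(W)], ν) →L[ℂ] C([G_U], ℂ)` — the literal shape of
the S4 field `TΦc_add` on a kernel-model core `𝒯_Φ := opTC (θ_Φ) ν` (§3 + §4). -/
theorem opTC_θ_add (Φ Ψ : M.SK) : opTC (M.θ (Φ + Ψ)) ν = opTC (M.θ Φ) ν + opTC (M.θ Ψ) ν := by
  rw [θ_add, opTC_add_kernel]

/-- **`𝒯_{θ_{aΦ}} = a • 𝒯_{θ_Φ}`** — the literal shape of the S4 field `TΦc_smul` on a kernel-model core. -/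
theorem opTC_θ_smul (a : ℂ) (Φ : M.SK) : opTC (M.θ (a • Φ)) ν = a • opTC (M.θ Φ) ν := by
  rw [θ_smul, opTC_smul_kernel]


-- port_pkg: scope closed for this part
end WeilThetaModel
end HodgeCM
end
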